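import Literature.AnabelianGeometry.AbsoluteAnabelian.AbsTopII.InertiaDecompositionMoreoverProofs
import Literature.AnabelianGeometry.AbsoluteAnabelian.AbsTopII.DPSCDataOfEmbedding

/-!
# [AbsTopII] Prop 1.3: the inputs "`I_v ⊆ I_e`" ((ii)) and "`I_e, I_v ⊆ D_e ∩ Π_I`, `I_e` commutes with `I_v`"
# ((iii), cusp) PROVED from the branch inclusions `Π_e ⊆ Π_v` of [CombGC] Def 1.1

S. Mochizuki, *Topics in Absolute Anabelian Geometry II* [AbsTopII] (bib `MochizukiAbsTopII2013`;
locators = PDF pages of the kurims manuscript `paper:url-585b8d0ad0d9`), §1, Def 1.2 (ii) p. 10,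
Prop 1.3 (ii), (iii), (iv) pp. 11–12, proofs p. 13 – p. 14 l. 6; S. Mochizuki, *A combinatorial version
of the Grothendieck conjecture* [CombGC] (bib `MochizukiCombGC2007`), Def 1.1 (ii) pp. 6–7 (a branch of an
edge `e` abutting to `v` gives `Π_e ↪ Π_v`, i.e. `Π_e ⊆ Π_v` for appropriate conjugates — abc-iut-L3's
`PSCDatum.nodeGp_le` / `PSCDatum.cuspGp_le`).

PROOF-ONLY (no definition).  The cell's sub-DAG `plan/L4/SUBDAG-AbsTopII-Prop13.md` carries two printed
inputs labelled "immediate from the definitions" as HYPOTHESES of its closers: row **I-cuspconj** (Prop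
1.3 (iii) proof p. 13: "[for appropriate choices of conjugates] it follows immediately from the
definitions that we have inclusions `I_e, I_v ⊆ D_e ∩ Π_I`, and that `I_e` commutes with `I_v`" — the
hypothesis `hcusp` of abc-iut-L4-t6's `DPSCIndexData.prop_1_3_iii'_of_inputs`, p427149), and the (ii)
clause "Now it follows immediately from the definitions that `I_v, I_{v′} ⊆ I_e`" (p. 13 l. 17; two
conjuncts of the hypothesis `hbranch` of `DPSCData.prop13iv_moreover_of_inputs`, p437485).  With
abc-iut-L4-t4's REAL definitions `I_v := Z_{Π_I}(Π_v)`, `I_e := Z_{Π_I}(Π_e)` (node), `I_e := Π_e`,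
`D_e := N_{Π_H}(Π_e)` (cusp) (`AbsTopII/DecompositionGroups.lean`), BOTH follow from the `Π_𝔾`-level
branch inclusion `Π_e ⊆ g·Π_v·g⁻¹` alone, because the centraliser is antitone:
`g·I_v·g⁻¹ = Z_{Π_I}(g·Π_v·g⁻¹) ⊆ Z_{Π_I}(Π_e)`, and `Z(Π_e) ⊆ N(Π_e) = D_e`, `Z(Π_e)` commutes with
`Π_e = I_e`.  PROVED here:
* `DPSCData.conj_Iv_le_IvNode_of_nodeSub_le` — (ii) "`I_v ⊆ I_e`" from `Π_e ⊆ gΠ_vg⁻¹` (node);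
* `DPSCData.cuspconj_of_cuspSub_le` — row I-cuspconj from `Π_e ⊆ gΠ_vg⁻¹` (cusp);
* re-keyed closers `DPSCIndexData.prop_1_3_iii'_of_branch` (F-0299 from I-C12ii, I-slimv, I-surj, the
  `Ẑ^Σ`-clause and the cusp branch inclusions), `DPSCIndexData.prop_1_3_viii'_of_branch` ((viii)′ with
  the (ii)/(iii) inclusion of its «Moreover» input re-keyed to "`Π_e, γΠ_{e′}γ⁻¹ ⊆ hΠ_vh⁻¹`", a
  `Π_𝔾`-level configuration) and `DPSCData.prop13iv_moreover_of_branch` /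
  `DPSCIndexData.prop13iv_moreover_of_prop_1_3'` (the «Moreover» clauses of (iv) with the branch
  configuration reduced to `Π_e ⊆ γΠ_vγ⁻¹, γ′Π_{v′}γ′⁻¹` + the finite-index clause of (ii));
* at the CONSTRUCTED DPSC data `DPSCData.ofEmbedding` of a PSC datum `G` embedded in a profinite
  extension (abc-iut-w5-d226, `AbsTopII/DPSCDataOfEmbedding.lean`): `cuspSub_le_conj_vertSub_ofEmbedding`,
  `nodeSub_le_conj_vertSub_ofEmbedding` UNCONDITIONALLY from abc-iut-L3's `PSCDatum.cuspGp_le` /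
  `nodeGp_le` BY NAME, hence `cuspconj_ofEmbedding`: row I-cuspconj holds with NO hypothesis at every
  embedded datum.
HONEST FRAMING: classical group theory; the remaining geometric inputs (I-surj, the `Ẑ^Σ`-clauses, the
finite-index clause of (ii), the trichotomy/CLAIM of (iv)) stay hypotheses; typed ≠ proved; nothing
here bears on [IUTchIII] Cor 3.12.  Cell abc-iut, seat f-069 (gen 3), row «P13-BRANCH-INPUTS».
-/

open scoped Pointwise

namespace Literature.AnabelianGeometry.AbsoluteAnabelian

open Literature.AnabelianGeometry.SemiGraphs

universe u

/-! ## §A. Conjugates through a homomorphism -/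

section GroupTheory

variable {P : Type u} {E : Type u} [Group P] [Group E]

/-- `ι(g·K·g⁻¹) = ι(g)·ι(K)·ι(g)⁻¹` for a homomorphism `ι` (the `ConjAct` spelling of abc-iut-L3 on the
left, the `MulAut.conj` spelling of abc-iut-L4 on the right). [folklore] -/
private theorem map_toConjAct_smul_eq_conj_smul_map (ι : P →* E) (g : P) (K : Subgroup P) :
    (ConjAct.toConjAct g • K).map ι = MulAut.conj (ι g) • K.map ι := by
  apply le_antisymm
  · rintro _ ⟨y, hy, rfl⟩
    rw [SetLike.mem_coe, Subgroup.mem_smul_pointwise_iff_exists] at hy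
    obtain ⟨k, hk, rfl⟩ := hy
    rw [Subgroup.mem_smul_pointwise_iff_exists]
    refine ⟨ι k, Subgroup.mem_map_of_mem ι hk, ?_⟩
    rw [ConjAct.toConjAct_smul, MulAut.smul_def, MulAut.conj_apply, map_mul, map_mul, map_inv]
  · intro x h
    rw [Subgroup.mem_smul_pointwise_iff_exists] at h
    obtain ⟨_, ⟨k, hk, rfl⟩, rfl⟩ := h
    refine ⟨ConjAct.toConjAct g • k, Subgroup.smul_mem_pointwise_smul _ _ _ hk, ?_⟩
    rw [ConjAct.toConjAct_smul, MulAut.smul_def, MulAut.conj_apply, map_mul, map_mul, map_inv]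

/-- `g·N_G(K)·g⁻¹ = N_G(g·K·g⁻¹)` (twin of the private transport lemma of
`AbsTopII/Prop13ConjugacyScope.lean`). [folklore] -/
private theorem conj_smul_normalizer' {G : Type u} [Group G] (g : G) (K : Subgroup G) :
    MulAut.conj g • Subgroup.normalizer (K : Set G) =
      Subgroup.normalizer ((MulAut.conj g • K : Subgroup G) : Set G) := by
  have h1 : ∀ S : Subgroup G, MulAut.conj g • S = S.map (MulAut.conj g).toMonoidHom := fun S => rfl
  rw [h1, h1, Subgroup.map_equiv_normalizer_eq]

end GroupTheory

/-! ## §B. At the DPSC data: inertia of a branch vertex centralises the edge group -/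

namespace DPSCData

variable (X : DPSCData.{u})

/-- **The centraliser is antitone**: if `K ⊆ g·Π_v·g⁻¹` then `g·I_v·g⁻¹ = Z_{Π_I}(g·Π_v·g⁻¹) ⊆ Z(K) ∩ Π_I`
(Def 1.2 (ii): `I_v := Z_{Π_I}(Π_v)`). [cite: MochizukiAbsTopII2013, Def 1.2 (ii) p.10] -/
theorem conj_Iv_le_centralizer_inf_of_le {K : Subgroup X.PiH} {v : X.Vert} {g : X.PiH}
    (h : K ≤ MulAut.conj g • X.vertSub v) :
    MulAut.conj g • X.Iv v ≤ Subgroup.centralizer (K : Set X.PiH) ⊓ X.PiI := by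
  rw [X.conj_smul_Iv v g]
  exact inf_le_inf_right _ (Subgroup.centralizer_le h)

/-- **Prop 1.3 (ii), "it follows immediately from the definitions that `I_v, I_{v′} ⊆ I_e`"** (proof
p. 13 l. 17), PROVED from the branch inclusion `Π_e ⊆ g·Π_v·g⁻¹` of the node `e` at `v` ([CombGC] Def 1.1
(ii)): `g·I_v·g⁻¹ = Z_{Π_I}(gΠ_vg⁻¹) ⊆ Z_{Π_I}(Π_e) = I_e`. [cite: MochizukiAbsTopII2013, Prop 1.3 (ii) proof p.13] -/
theorem conj_Iv_le_IvNode_of_nodeSub_le {e : X.Node} {v : X.Vert} {g : X.PiH}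
    (h : X.nodeSub e ≤ MulAut.conj g • X.vertSub v) : MulAut.conj g • X.Iv v ≤ X.IvNode e :=
  X.conj_Iv_le_centralizer_inf_of_le h

/-- **Row I-cuspconj of the sub-DAG, PROVED** — Prop 1.3 (iii) proof p. 13: "Now suppose that `e` is a
cusp that abuts to `v`. Then [for appropriate choices of conjugates] it follows immediately from the
definitions that we have inclusions `I_e, I_v ⊆ D_e ∩ Π_I`, and that `I_e` commutes with `I_v`" — from the
branch inclusion `Π_e ⊆ g·Π_v·g⁻¹` ([CombGC] Def 1.1 (ii)): `g·I_v·g⁻¹ ⊆ Z_{Π_I}(Π_e) ⊆ N_{Π_H}(Π_e) ∩ Π_I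
= D_e ∩ Π_I`, and `Z(Π_e)` commutes with `Π_e = I_e`.  This is VERBATIM the hypothesis `hcusp e` of
`DPSCIndexData.prop_1_3_iii'_of_inputs` / the pair `(hle, hcomm)` of `DPSCData.isInternalProduct_IvCusp`.
[cite: MochizukiAbsTopII2013, Prop 1.3 (iii) proof p.13] -/
theorem cuspconj_of_cuspSub_le {e : X.Cusp} {g : X.PiH}
    (h : X.cuspSub e ≤ MulAut.conj g • X.vertSub (X.cuspVert e)) :
    MulAut.conj g • X.Iv (X.cuspVert e) ≤ X.DvCusp e ⊓ X.PiI ∧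
      ∀ a ∈ X.IvCusp e, ∀ b ∈ MulAut.conj g • X.Iv (X.cuspVert e), a * b = b * a := by
  have hZ := X.conj_Iv_le_centralizer_inf_of_le h
  refine ⟨le_trans hZ (inf_le_inf_right _ (Subgroup.centralizer_le_normalizer _)), fun a ha b hb => ?_⟩
  have hb' : b ∈ Subgroup.centralizer (X.cuspSub e : Set X.PiH) := (hZ hb).1
  rw [Subgroup.mem_centralizer_iff] at hb'
  exact hb' a ha

/-- If an edge group `K` (or any subgroup) lies in `h·Π_v·h⁻¹`, then `h·I_v·h⁻¹ ⊆ N_{Π_H}(K) ∩ Π_I` — for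
`K = Π_e`: "`I_v ⊆ D_e ∩ Π_I`" ((iii) p. 13; (viii) p. 16 "by assertions (ii), (iii), [for appropriate
choices of conjugates] `I_v ⊆ D_e ∩ D_{e′} ∩ Π_I`"). [cite: MochizukiAbsTopII2013, Prop 1.3 (viii) proof p.16] -/
theorem conj_Iv_le_normalizer_inf_of_le {K : Subgroup X.PiH} {v : X.Vert} {h : X.PiH}
    (hK : K ≤ MulAut.conj h • X.vertSub v) :
    MulAut.conj h • X.Iv v ≤ Subgroup.normalizer (K : Set X.PiH) ⊓ X.PiI :=
  le_trans (X.conj_Iv_le_centralizer_inf_of_le hK) (inf_le_inf_right _ (Subgroup.centralizer_le_normalizer _))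

/-- (iii) p. 13, the cusp clause, from the branch inclusion: "`1 → I_e → D_e ∩ Π_I → I → 1`" and "`I_e × I_v
→ D_e ∩ Π_I` is an isomorphism" for the conjugate `g·I_v·g⁻¹` of the branch vertex — abc-iut-L4-t6's
`isInternalProduct_IvCusp` with its inputs `(hle, hcomm)` DISCHARGED by `cuspconj_of_cuspSub_le`.
[cite: MochizukiAbsTopII2013, Prop 1.3 (iii) proof p.13] -/
theorem isInternalProduct_IvCusp_of_cuspSub_le
    (hCTc : ∀ e : X.Cusp, IsCommensurablyTerminal ((X.cuspSub e).subgroupOf X.PiG))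
    (h13iii : X.Prop13iii) (e : X.Cusp) {g : X.PiH}
    (h : X.cuspSub e ≤ MulAut.conj g • X.vertSub (X.cuspVert e)) :
    AbsTopII.IsInternalProduct (X.IvCusp e) (MulAut.conj g • X.Iv (X.cuspVert e)) (X.DvCusp e ⊓ X.PiI) ∧
      (X.DvCusp e ⊓ X.PiI) ⊓ X.PiG = X.IvCusp e ∧ (X.DvCusp e ⊓ X.PiI) ⊔ X.PiG = X.PiI :=
  X.isInternalProduct_IvCusp hCTc h13iii e g (X.cuspconj_of_cuspSub_le h).1 (X.cuspconj_of_cuspSub_le h).2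

/-- **[AbsTopII] Prop 1.3 (iv), the «Moreover» clauses AS TYPED, with the branch configuration reduced
to the branch inclusions** (the two conjuncts "`γI_vγ⁻¹, γ′I_{v′}γ′⁻¹ ⊆ I_e`" of the hypothesis `hbranch`
of `prop13iv_moreover_of_inputs` DISCHARGED by `conj_Iv_le_IvNode_of_nodeSub_le`): the branch input is now
"`Π_e ⊆ γΠ_vγ⁻¹`, `Π_e ⊆ γ′Π_{v′}γ′⁻¹` ([CombGC] Def 1.1 (ii)) with `γI_vγ⁻¹ · γ′I_{v′}γ′⁻¹` of finite
index in `I_e` (Prop 1.3 (ii): image of index `i^Σ_e`)"; the other hypotheses as there.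
[cite: MochizukiAbsTopII2013, Prop 1.3 (iv) p.12] -/
theorem prop13iv_moreover_of_branch (hiv : X.Prop13iv')
    (hbranch : ∀ (v v' : X.Vert) (e : X.Node), v ≠ v' → X.nodeAbuts e v → X.nodeAbuts e v' →
      ∃ γ γ' : X.PiH, γ ∈ X.PiG ∧ γ' ∈ X.PiG ∧
        X.nodeSub e ≤ MulAut.conj γ • X.vertSub v ∧ X.nodeSub e ≤ MulAut.conj γ' • X.vertSub v' ∧
        (MulAut.conj γ • X.Iv v ⊔ MulAut.conj γ' • X.Iv v').relIndex (X.IvNode e) ≠ 0)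
    (hEG : ∀ e : X.Node, X.IvNode e ⊓ X.PiG = X.nodeSub e)
    (hsurj : ∀ v : X.Vert, X.Iv v ⊔ X.PiG = X.PiI)
    (hZ : ∀ v : X.Vert, X.Dv v ⊓ X.PiI ≤ Subgroup.centralizer (X.Iv v : Set X.PiH))
    (hC : ∀ e : X.Node, Subgroup.Commensurable.commensurator (X.nodeSub e) ⊓ X.PiI ≤ X.IvNode e)
    (hDG : ∀ v : X.Vert, X.Dv v ⊓ X.PiG = X.vertSub v)
    (hclaim : ∀ (v v' : X.Vert) (γ : X.PiH), v ≠ v' → ¬ X.Adjacent v v' → γ ∈ X.PiG →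
      X.vertSub v ⊓ MulAut.conj γ • X.vertSub v' = ⊥) :
    Literature.AnabelianGeometry.AbsoluteAnabelian.DPSCData.Prop13iv_moreover X :=
  X.prop13iv_moreover_of_inputs hiv (fun v v' e hne hv hv' => by
      obtain ⟨γ, γ', hγ, hγ', hPv, hPv', hfin⟩ := hbranch v v' e hne hv hv'
      exact ⟨γ, γ', hγ, hγ', hPv, hPv', X.conj_Iv_le_IvNode_of_nodeSub_le hPv,
        X.conj_Iv_le_IvNode_of_nodeSub_le hPv', hfin⟩)
    hEG hsurj hZ hC hDG hclaim

/-! ### At the constructed DPSC data of an embedded PSC datum: the branch inclusions from layer L3 -/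

section Embedding

variable {P : Type u} [Group P] [TopologicalSpace P]
  (G : PSCDatum P) (E : ProfiniteGrp.{u}) (ι : P →* E)
  (hιr : IsClosed (ι.range : Set E)) (hιn : ι.range.Normal)
  (PiI : Subgroup E) (hIn : PiI.Normal) (hle : ι.range ≤ PiI)

/-- **The cusp branch inclusion at `ofEmbedding`, from abc-iut-L3's `PSCDatum.cuspGp_le` BY NAME**: for
every cusp `c` of the embedded datum some `Π_𝔾`-conjugate of `Π_{v(c)}` contains `Π_c` ([CombGC] Def 1.1
(ii): the verticial branch of `c`). [cite: MochizukiCombGC2007, Def 1.1(ii) p.7] -/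
theorem cuspSub_le_conj_vertSub_ofEmbedding (c : (ofEmbedding G E ι hιr hιn PiI hIn hle).Cusp) :
    ∃ g : (ofEmbedding G E ι hιr hιn PiI hIn hle).PiH, g ∈ (ofEmbedding G E ι hιr hιn PiI hIn hle).PiG ∧
      (ofEmbedding G E ι hιr hιn PiI hIn hle).cuspSub c ≤
        MulAut.conj g • (ofEmbedding G E ι hιr hιn PiI hIn hle).vertSub
          ((ofEmbedding G E ι hιr hιn PiI hIn hle).cuspVert c) := by
  obtain ⟨γ, hγ⟩ := G.cuspGp_le c.down
  refine ⟨ι (ConjAct.ofConjAct γ)⁻¹, ⟨(ConjAct.ofConjAct γ)⁻¹, rfl⟩, ?_⟩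
  have h := Subgroup.map_mono (f := ι) hγ
  rw [← ConjAct.toConjAct_ofConjAct γ, map_toConjAct_smul_eq_conj_smul_map, Subgroup.pointwise_smul_subset_iff,
    ← map_inv, ← map_inv] at h
  exact h

/-- **The node branch inclusions at `ofEmbedding`, from abc-iut-L3's `PSCDatum.nodeGp_le` BY NAME**: for a
node `e` abutting to `v`, some `Π_𝔾`-conjugate of `Π_v` contains `Π_e` ([CombGC] Def 1.1 (ii): each branch
of `e` gives `Π_e ↪ Π_v`). [cite: MochizukiCombGC2007, Def 1.1(ii) p.7] -/
theorem nodeSub_le_conj_vertSub_ofEmbedding (e : (ofEmbedding G E ι hιr hιn PiI hIn hle).Node)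
    (v : (ofEmbedding G E ι hιr hιn PiI hIn hle).Vert)
    (hv : (ofEmbedding G E ι hιr hιn PiI hIn hle).nodeAbuts e v) :
    ∃ g : (ofEmbedding G E ι hιr hιn PiI hIn hle).PiH, g ∈ (ofEmbedding G E ι hιr hιn PiI hIn hle).PiG ∧
      (ofEmbedding G E ι hιr hιn PiI hIn hle).nodeSub e ≤
        MulAut.conj g • (ofEmbedding G E ι hιr hιn PiI hIn hle).vertSub v := by
  obtain ⟨v₁, v₂, hends, ⟨γ₁, hγ₁⟩, ⟨γ₂, hγ₂⟩⟩ := G.nodeGp_le e.down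
  -- `v` is one of the two ends of `e`
  have hv' : v.down = v₁ ∨ v.down = v₂ := by
    change v.down ∈ G.graph.nodeEnds e.down at hv
    rw [hends] at hv
    exact Sym2.mem_iff.mp hv
  -- the branch at that end
  obtain ⟨γ, hγ⟩ : ∃ γ : ConjAct P, γ • G.nodeGp e.down ≤ G.vertGp v.down := by
    rcases hv' with h | h
    · exact ⟨γ₁, h ▸ hγ₁⟩
    · exact ⟨γ₂, h ▸ hγ₂⟩
  refine ⟨ι (ConjAct.ofConjAct γ)⁻¹, ⟨(ConjAct.ofConjAct γ)⁻¹, rfl⟩, ?_⟩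
  have h := Subgroup.map_mono (f := ι) hγ
  rw [← ConjAct.toConjAct_ofConjAct γ, map_toConjAct_smul_eq_conj_smul_map, Subgroup.pointwise_smul_subset_iff,
    ← map_inv, ← map_inv] at h
  exact h

/-- **Row I-cuspconj holds with NO hypothesis at every embedded datum**: the input `hcusp` of
`DPSCIndexData.prop_1_3_iii'_of_inputs` / `(hle, hcomm)` of `DPSCData.isInternalProduct_IvCusp`, for the
`Π_𝔾`-conjugate of `I_{v(c)}` given by L3's branch datum. [cite: MochizukiAbsTopII2013, Prop 1.3 (iii) proof p.13] -/
theorem cuspconj_ofEmbedding (c : (ofEmbedding G E ι hιr hιn PiI hIn hle).Cusp) :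
    ∃ g : (ofEmbedding G E ι hιr hιn PiI hIn hle).PiH, g ∈ (ofEmbedding G E ι hιr hιn PiI hIn hle).PiG ∧
      MulAut.conj g • (ofEmbedding G E ι hιr hιn PiI hIn hle).Iv ((ofEmbedding G E ι hιr hιn PiI hIn hle).cuspVert c) ≤
          (ofEmbedding G E ι hιr hιn PiI hIn hle).DvCusp c ⊓ (ofEmbedding G E ι hιr hιn PiI hIn hle).PiI ∧
        ∀ a ∈ (ofEmbedding G E ι hιr hιn PiI hIn hle).IvCusp c,
          ∀ b ∈ MulAut.conj g • (ofEmbedding G E ι hιr hιn PiI hIn hle).Iv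
            ((ofEmbedding G E ι hιr hιn PiI hIn hle).cuspVert c), a * b = b * a := by
  obtain ⟨g, hg, h⟩ := cuspSub_le_conj_vertSub_ofEmbedding G E ι hιr hιn PiI hIn hle c
  exact ⟨g, hg, (ofEmbedding G E ι hιr hιn PiI hIn hle).cuspconj_of_cuspSub_le h⟩

end Embedding

end DPSCData

/-! ## §C. Re-keyed closers at `DPSCIndexData` -/

namespace AbsTopII.DPSCIndexData

variable (X : DPSCIndexData.{u})

/-- **[AbsTopII] Prop 1.3 (iii) (rest) AS TYPED** (`DPSCIndexData.Prop_1_3_iii'`, F-0299) **from its printed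
inputs, the cusp input I-cuspconj now DISCHARGED**: abc-iut-L4-t6's `prop_1_3_iii'_of_inputs` (p427149)
with its hypothesis `hcusp` ("an appropriate conjugate of `I_v` inside `D_e ∩ Π_I` commuting with `I_e`")
replaced by the branch inclusion `Π_e ⊆ g·Π_{v(e)}·g⁻¹` ([CombGC] Def 1.1 (ii); L3's `PSCDatum.cuspGp_le`).
Remaining inputs: [CombGC] Prop 1.2 (ii) for vertices and cusps, slimness of `Π_v` (Rmk 1.1.3),
"`I_v ↠ I`", "`I_v ≅ Ẑ^Σ`". [cite: MochizukiAbsTopII2013, Prop 1.3 (iii) p.11] -/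
theorem prop_1_3_iii'_of_branch
    (hCTv : ∀ v : X.Vert, IsCommensurablyTerminal ((X.vertSub v).subgroupOf X.PiG))
    (hCTc : ∀ e : X.Cusp, IsCommensurablyTerminal ((X.cuspSub e).subgroupOf X.PiG))
    (hslim : ∀ v : X.Vert, Literature.AlgebraicGeometry.Frobenioids.IsSlimGroup ↥(X.vertSub v))
    (hsurj : ∀ v : X.Vert, X.Iv v ⊔ X.PiG = X.PiI)
    (hcyc : ∀ v : X.Vert, IsFreeProSigmaCyclic X.Sigma ↥(X.Iv v))
    (hbranch : ∀ e : X.Cusp, ∃ g : X.PiH, X.cuspSub e ≤ MulAut.conj g • X.vertSub (X.cuspVert e)) :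
    Literature.AnabelianGeometry.AbsoluteAnabelian.AbsTopII.DPSCIndexData.Prop_1_3_iii' X :=
  X.prop_1_3_iii'_of_inputs hCTv hCTc hslim hsurj hcyc fun e => by
    obtain ⟨g, hg⟩ := hbranch e
    exact ⟨g, X.toDPSCData.cuspconj_of_cuspSub_le hg⟩

/-- The decomposition group of an edge is the normaliser of its edge group (Def 1.2 (ii)), uniformly in
the edge kind: `D_e = N_{Π_H}(Π_e)` with `Π_e = Sum.elim Π_node Π_cusp e`. [cite: MochizukiAbsTopII2013, Def 1.2 (ii) p.10] -/
theorem DEdge_eq_normalizer (e : X.Edge) :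
    X.DEdge e = Subgroup.normalizer ((Sum.elim X.nodeSub X.cuspSub e : Subgroup X.PiH) : Set X.PiH) := by
  cases e <;> rfl

/-- … and for a `Π_𝔾`-conjugate: `γ·D_e·γ⁻¹ = N_{Π_H}(γ·Π_e·γ⁻¹)`. [cite: MochizukiAbsTopII2013, Def 1.2 (ii) p.10] -/
theorem conj_DEdge_eq_normalizer (e : X.Edge) (γ : X.PiH) :
    MulAut.conj γ • X.DEdge e =
      Subgroup.normalizer ((MulAut.conj γ • (Sum.elim X.nodeSub X.cuspSub e) : Subgroup X.PiH) : Set X.PiH) := by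
  rw [X.DEdge_eq_normalizer e]
  exact conj_smul_normalizer' γ _

/-- **[AbsTopII] Prop 1.3 (viii) AS TYPED (`Prop_1_3_viii'`), the (ii)/(iii) inclusion of its «Moreover»
input RE-KEYED to the `Π_𝔾`-level configuration**: `prop_1_3_viii'_of_inputs` (p437485) asked, in
situation (2), for a `Π_𝔾`-conjugate `hI_vh⁻¹ ⊆ D_e ∩ γD_{e′}γ⁻¹ ∩ Π_I` ("by assertions (ii), (iii), [for
appropriate choices of conjugates]", p. 16); by `conj_Iv_le_normalizer_inf_of_le` it suffices that the two
edge groups, as positioned, lie in ONE conjugate verticial subgroup: `Π_e, γΠ_{e′}γ⁻¹ ⊆ hΠ_vh⁻¹` (the two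
(pro-)edges abut to a common (pro-)vertex — [CombGC] Def 1.1 (ii) branch data).  The dichotomy (1)/(2)
itself (pp. 16–19, log étale cyclic coverings) and "`I_v ↠ I`" remain the hypotheses.
[cite: MochizukiAbsTopII2013, Prop 1.3 (viii) p.12] -/
theorem prop_1_3_viii'_of_branch
    (hdich : ∀ (e e' : X.Edge) (γ : X.PiH), γ ∈ X.PiG →
      X.DEdge e ⊓ MulAut.conj γ • X.DEdge e' ⊓ X.PiI ≠ ⊥ →
      e = e' ∨
        (e ≠ e' ∧ ∃ v : X.Vert, X.EdgeAbuts e v ∧ X.EdgeAbuts e' v ∧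
          X.DEdge e ⊓ MulAut.conj γ • X.DEdge e' ⊓ X.PiG = ⊥ ∧
          ∃ h : X.PiH, h ∈ X.PiG ∧
            (Sum.elim X.nodeSub X.cuspSub e : Subgroup X.PiH) ≤ MulAut.conj h • X.vertSub v ∧
            MulAut.conj γ • (Sum.elim X.nodeSub X.cuspSub e' : Subgroup X.PiH) ≤
              MulAut.conj h • X.vertSub v))
    (hsurj : ∀ v : X.Vert, X.Iv v ⊔ X.PiG = X.PiI) :
    Literature.AnabelianGeometry.AbsoluteAnabelian.AbsTopII.DPSCIndexData.Prop_1_3_viii' X := by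
  refine X.prop_1_3_viii'_of_inputs (fun e e' γ hγ hne => ?_) hsurj
  rcases hdich e e' γ hγ hne with h | ⟨hne', v, hv, hv', hbot, h, hh, hle, hle'⟩
  · exact Or.inl h
  · refine Or.inr ⟨hne', v, hv, hv', hbot, h, hh, le_inf (le_inf ?_ ?_) ?_⟩
    · rw [X.DEdge_eq_normalizer e]
      exact le_trans (X.toDPSCData.conj_Iv_le_normalizer_inf_of_le hle) inf_le_left
    · rw [X.conj_DEdge_eq_normalizer e' γ]
      exact le_trans (X.toDPSCData.conj_Iv_le_normalizer_inf_of_le hle') inf_le_left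
    · exact le_trans (X.toDPSCData.conj_Iv_le_normalizer_inf_of_le hle) inf_le_right

/-- **[AbsTopII] Prop 1.3 (iv), «Moreover» clauses, from the TYPED (ii), (iii), (iv)′, (v), (v)′, (vii)**
BY NAME + the branch inclusions with the finite-index clause of (ii) + the CLAIM of p. 14 —
`prop13iv_moreover_of_prop_1_3` (p437485) with the two "`I_v ⊆ I_e`" conjuncts of its branch input
DISCHARGED. [cite: MochizukiAbsTopII2013, Prop 1.3 (iv) p.12] -/
theorem prop13iv_moreover_of_prop_1_3'
    (hii : X.Prop_1_3_ii') (hiii : X.Prop13iii) (hiv : X.Prop13iv') (hv : X.Prop13v)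
    (hv' : X.Prop_1_3_v') (hvii : X.Prop13vii)
    (hbranch : ∀ (v v' : X.Vert) (e : X.Node), v ≠ v' → X.nodeAbuts e v → X.nodeAbuts e v' →
      ∃ γ γ' : X.PiH, γ ∈ X.PiG ∧ γ' ∈ X.PiG ∧
        X.nodeSub e ≤ MulAut.conj γ • X.vertSub v ∧ X.nodeSub e ≤ MulAut.conj γ' • X.vertSub v' ∧
        (MulAut.conj γ • X.Iv v ⊔ MulAut.conj γ' • X.Iv v').relIndex (X.IvNode e) ≠ 0)
    (hclaim : ∀ (v v' : X.Vert) (γ : X.PiH), v ≠ v' → ¬ X.Adjacent v v' → γ ∈ X.PiG →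
      X.vertSub v ⊓ MulAut.conj γ • X.vertSub v' = ⊥) :
    Literature.AnabelianGeometry.AbsoluteAnabelian.DPSCData.Prop13iv_moreover X.toDPSCData :=
  X.prop13iv_moreover_of_prop_1_3 hii hiii hiv hv hv' hvii (fun v v' e hne hv hv' => by
      obtain ⟨γ, γ', hγ, hγ', hPv, hPv', hfin⟩ := hbranch v v' e hne hv hv'
      exact ⟨γ, γ', hγ, hγ', hPv, hPv', X.toDPSCData.conj_Iv_le_IvNode_of_nodeSub_le hPv,
        X.toDPSCData.conj_Iv_le_IvNode_of_nodeSub_le hPv', hfin⟩)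
    hclaim

end AbsTopII.DPSCIndexData

end Literature.AnabelianGeometry.AbsoluteAnabelian
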